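import Summits.AtomisticToContinuum.BoseEinsteinCondensation.Theorems.BECGroundStateSOSBoundaryTransferWeakHardWallLimitCutoffNorm

/-!
# Route `BECGroundStateSOS`, crux `BoundaryTransferWeak` (stmt-AtomisticToContinuum-0827),
# line `rim-squeeze-monotone-coherence`, stub (L): the rim-layer cutoff, II (energy and `L²` costs)

Supports (does not close) stmt-AtomisticToContinuum-0827; auxiliary block of the registered stub
`stub_hardWallLimit` (L) (lead c3), sequel of `…HardWallLimitCutoffNorm.lean` (profile, pointwise
facts, `1 - m ≤ ‖F‖² ≤ 1` for the cut-off `F(X) = Ψ(X - 2h𝟙) ∏_{i,k} q(x_{ik})` of a periodic trial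
state `Ψ` with rim mass `m`). Here the three costs of the cut-off, each a rim mass because the
shifted ramps sit in the periodised rim:

* `lintegral_kineticDensity_cutoff_le` — `∫|∇F|² ≤ (1+η) ∫_cell |∇Ψ|² + (1+η⁻¹) D² · 3m`
  (Young parameter `η > 0`; pointwise bound `ennnorm_fderiv_cutoffState_sq_le_eta` of the tree,
  torus translation invariance `lintegral_cellN_comp_add`, and
  `Σ_{i,k} 1_{rimPer}(y_{ik}) ≤ 3 Σ_j 1_rim(y_j)` on the cell);
* `lintegral_interaction_cutoff_le` — `∫ V|F|² ≤ ∫_cell V^per |Ψ|²` for EVERY pair potential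
  (distances are untouched: hard cores included);
* `lintegral_cutoff_sub_sq_add_le` — `∫ |F - 1_cell Ψ(· - 2h𝟙)|² + ‖F‖² ≤ 1` (pointwise
  `(1-Q)² + Q² ≤ 1`), i.e. `∫ |F - 1_cell Ψ(· - 2h𝟙)|² ≤ m`;
* `lintegral_form_cutoff_le` (anchor `stub_hardWallLimit_cutoffEnergy`) — the quadratic form:
  `∫|∇F|² + ∫V|F|² ≤ (1+η) periodicEnergy v Ψ + (1+η⁻¹) D² · 3m`.

The normalised state and its bookkeeping follow in `…HardWallLimitCutoffState.lean`. All `[folklore]`.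
-/

noncomputable section

namespace Summit.AtomisticToContinuum.BoseEinsteinCondensation.RimSqueeze

open Literature.MathematicalPhysics.QuantumManyBody.BoseGas
open MeasureTheory Filter Set
open scoped ENNReal NNReal ComplexConjugate

variable {N : ℕ} {L h D : ℝ} {q : ℝ → ℝ}

/-- **Kinetic energy of the cut-off.** With a Young parameter `η > 0`:
`∫ |∇F|² ≤ (1+η) ∫_{cell} |∇Ψ|² + (1+η⁻¹) D² · 3 m`. Pointwise
(`ennnorm_fderiv_cutoffState_sq_le_eta`) `|∂_{ik}F|² ≤ Q²|∂_{ik}Ψ(X+U)|²(1+η) +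
(1+η⁻¹)D² 1_ramp(x_{ik}) |Ψ(X+U)|²`; `Q² ≤ 1_cell`, the ramps moved by `-2h` lie in the
periodised rim (`mem_rimPer_of_mem_ramp`), and cell integrals of periodic integrands are
translation invariant (`lintegral_cellN_comp_add`), where `Σ_{i,k} 1_{rimPer}(y_{ik}) ≤ 3 Σ_j 1_rim(y_j)`
on the cell. [folklore] -/
theorem lintegral_kineticDensity_cutoff_le (hL : 0 < L) (hh : 0 < h) (h8 : 8 * h < L)
    (hq : IsCutoffProfile q (h / 2) (L / 2 + 3 * h) D) (Ψ : PeriodicTrialState N L) {η : ℝ}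
    (hη : 0 < η) :
    ∫⁻ X, kineticDensity (fun X : Config N => Ψ.ψ (X + fun _ =>
        (WithLp.toLp 2 fun _ : Fin 3 => -(2 * h) : Space)) *
        ((∏ p : Fin N × Fin 3, q (X p.1 p.2) : ℝ) : ℂ)) X ≤
      (1 + ENNReal.ofReal η) * (∫⁻ Y in cellN N L, kineticDensity Ψ.ψ Y) +
        (1 + ENNReal.ofReal η⁻¹) * ENNReal.ofReal (D ^ 2) *
          (3 * ∫⁻ Y in cellN N L, (∑ j, rimPot L (Y j)) * (‖Ψ.ψ Y‖₊ : ℝ≥0∞) ^ 2) := by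
  classical
  set u : Space := WithLp.toLp 2 fun _ : Fin 3 => -(2 * h) with hu
  set U : Config N := fun _ => u with hU
  set R : Set ℝ := {y : ℝ | ∃ m : ℤ, L / 2 ≤ y - m * L ∧ y - m * L < L} with hR
  set A : Set ℝ := Icc 0 (2 * (h / 2)) ∪ Icc (L / 2 + 3 * h) (L / 2 + 3 * h + 2 * (h / 2)) with hA
  have hS : L / 2 + 3 * h + 2 * (h / 2) ≤ L := by linarith
  set G₂ : Config N → ℝ≥0∞ := fun Y => (‖Ψ.ψ Y‖₊ : ℝ≥0∞) ^ 2 with hG₂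
  set H : Config N → ℝ≥0∞ := fun Y => G₂ Y * ∑ i : Fin N, ∑ k : Fin 3, R.indicator 1 (Y i k)
    with hH
  -- pointwise bound
  have hpt : ∀ X : Config N,
      kineticDensity (fun X : Config N => Ψ.ψ (X + U) *
        ((∏ p : Fin N × Fin 3, q (X p.1 p.2) : ℝ) : ℂ)) X ≤
      (1 + ENNReal.ofReal η) * (cellN N L).indicator (fun X => kineticDensity Ψ.ψ (X + U)) X +
        (1 + ENNReal.ofReal η⁻¹) * ENNReal.ofReal (D ^ 2) * (cellN N L).indicator
          (fun X => H (X + U)) X := by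
    intro X
    have hsum : kineticDensity (fun X : Config N => Ψ.ψ (X + U) *
        ((∏ p : Fin N × Fin 3, q (X p.1 p.2) : ℝ) : ℂ)) X ≤
        ∑ i : Fin N, ∑ k : Fin 3,
          ((1 + ENNReal.ofReal η) * ((cellN N L).indicator (1 : Config N → ℝ≥0∞) X *
            ((‖fderiv ℝ Ψ.ψ (X + U) (Pi.single i (EuclideanSpace.single k (1 : ℝ)))‖₊ : ℝ≥0∞)) ^ 2) +
          (1 + ENNReal.ofReal η⁻¹) * ENNReal.ofReal (D ^ 2) *
            ((cellN N L).indicator (1 : Config N → ℝ≥0∞) X * (G₂ (X + U) *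
              R.indicator 1 ((X + U) i k)))) := by
      unfold kineticDensity
      refine Finset.sum_le_sum fun i _ => Finset.sum_le_sum fun k _ => ?_
      refine (ennnorm_fderiv_cutoffState_sq_le_eta hq.contDiff Ψ.contDiff hq.range hq.deriv_le
        hq.deriv_support hη U X i k).trans ?_
      have hQ := ofReal_prodCutoff_sq_le_indicator (N := N) hq.range hq.support hS X
      refine add_le_add ?_ ?_
      · -- main term: `Q² ≤ 1_cell`, `1 + η 1_A ≤ 1 + η`
        have hind : A.indicator (1 : ℝ → ℝ≥0∞) (X i k) ≤ 1 := by
          by_cases hx : X i k ∈ A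
          · rw [indicator_of_mem hx, Pi.one_apply]
          · rw [indicator_of_notMem hx]; exact zero_le
        calc _ ≤ (cellN N L).indicator (1 : Config N → ℝ≥0∞) X *
              ((‖fderiv ℝ Ψ.ψ (X + U) (Pi.single i (EuclideanSpace.single k (1 : ℝ)))‖₊ : ℝ≥0∞)) ^ 2 *
              (1 + ENNReal.ofReal η * 1) := by gcongr
          _ = _ := by ring
      · -- ramp term: `1_A(x_{ik}) P² ≤ 1_cell(X) 1_R(x_{ik} - 2h)`
        by_cases hx : X i k ∈ A
        · by_cases hP : (∏ p ∈ Finset.univ.erase (i, k), q (X p.1 p.2)) = 0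
          · simp [hP]
          · have hXcell : X ∈ cellN N L := by
              intro j m
              by_cases hjm : (j, m) = (i, k)
              · obtain ⟨rfl, rfl⟩ := Prod.mk.injEq _ _ _ _ ▸ hjm
                rcases hx with ⟨h1, h2⟩ | ⟨h1, h2⟩
                · exact ⟨h1, by linarith⟩
                · exact ⟨by linarith, by linarith⟩
              · have hne := Finset.prod_ne_zero_iff.1 hP (j, m)
                  (Finset.mem_erase.2 ⟨hjm, Finset.mem_univ _⟩)
                have ht := hq.support _ hne
                exact ⟨ht.1.le, ht.2.trans_le hS⟩
            have hxR : (X + U) i k ∈ R := by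
              rw [hU, hu, shift_apply]
              exact mem_rimPer_of_mem_ramp hh h8 hx
            rw [indicator_of_mem hx, indicator_of_mem hXcell, indicator_of_mem hxR, Pi.one_apply,
              Pi.one_apply, Pi.one_apply, mul_one, one_mul, mul_one]
            calc _ ≤ (1 + ENNReal.ofReal η⁻¹) * ENNReal.ofReal (D ^ 2) * ENNReal.ofReal 1 *
                  G₂ (X + U) := by
                  gcongr
                  exact pow_le_one₀ (Finset.prod_nonneg fun _ _ => (hq.range _).1)
                    (Finset.prod_le_one (fun _ _ => (hq.range _).1) fun _ _ => (hq.range _).2)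
              _ = _ := by rw [ENNReal.ofReal_one, mul_one]
        · rw [indicator_of_notMem hx]
          simp
    refine hsum.trans (le_of_eq ?_)
    by_cases hX : X ∈ cellN N L
    · simp only [indicator_of_mem hX, Pi.one_apply, one_mul, Finset.sum_add_distrib,
        ← Finset.mul_sum, hH]
      rfl
    · simp only [indicator_of_notMem hX, zero_mul, mul_zero, Finset.sum_const_zero, add_zero]
  -- measurability of the main term
  have hKm : Measurable fun X => (cellN N L).indicator (fun X => kineticDensity Ψ.ψ (X + U)) X :=
    ((measurable_kineticDensity Ψ.contDiff).comp (measurable_id.add_const U)).indicator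
      (measurableSet_cellN N L)
  -- periodicity of the two cell integrands
  have hKper : ∀ (Y : Config N) (i : Fin N) (k : Fin 3),
      kineticDensity Ψ.ψ (Y + Pi.single i (EuclideanSpace.single k L)) = kineticDensity Ψ.ψ Y :=
    kineticDensity_add_single_of_periodic Ψ.periodic
  have hHper : ∀ (Y : Config N) (i' : Fin N) (k' : Fin 3),
      H (Y + Pi.single i' (EuclideanSpace.single k' L)) = H Y := by
    intro Y i' k'
    simp only [hH, hG₂, Ψ.periodic]
    congr 1
    refine Finset.sum_congr rfl fun i _ => Finset.sum_congr rfl fun k _ => ?_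
    rw [add_single_apply_apply]
    split_ifs
    · by_cases hy : Y i k ∈ R
      · have hy' : Y i k + L ∈ R := (mem_rimPer_add_iff L (Y i k)).2 hy
        rw [indicator_of_mem hy, indicator_of_mem hy', Pi.one_apply, Pi.one_apply]
      · have hy' : Y i k + L ∉ R := fun h' => hy ((mem_rimPer_add_iff L (Y i k)).1 h')
        rw [indicator_of_notMem hy, indicator_of_notMem hy']
    · rw [add_zero]
  -- on the cell, `Σ_{ik} 1_R(y_{ik}) ≤ 3 Σ_j 1_rim(y_j)`
  have hHle : ∀ Y ∈ cellN N L, H Y ≤ 3 * ((∑ j, rimPot L (Y j)) * G₂ Y) := by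
    intro Y hY
    have hik : ∀ i k, R.indicator (1 : ℝ → ℝ≥0∞) (Y i k) ≤ rimPot L (Y i) := by
      intro i k
      by_cases hy : Y i k ∈ R
      · rw [indicator_of_mem hy, Pi.one_apply, rimPot_apply,
          if_pos ⟨k, half_le_of_mem_rimPer (hY i k) hy⟩]
      · rw [indicator_of_notMem hy]; exact zero_le
    calc H Y = G₂ Y * ∑ i, ∑ k, R.indicator 1 (Y i k) := rfl
      _ ≤ G₂ Y * ∑ i, ∑ _k : Fin 3, rimPot L (Y i) := by
          gcongr with i _ k _
          exact hik i k
      _ = 3 * ((∑ j, rimPot L (Y j)) * G₂ Y) := by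
          simp only [Finset.sum_const, Finset.card_univ, Fintype.card_fin, nsmul_eq_mul]
          push_cast
          rw [← Finset.mul_sum]
          ring
  -- integrate
  calc _ ≤ ∫⁻ X, (1 + ENNReal.ofReal η) * (cellN N L).indicator
          (fun X => kineticDensity Ψ.ψ (X + U)) X +
        (1 + ENNReal.ofReal η⁻¹) * ENNReal.ofReal (D ^ 2) * (cellN N L).indicator
          (fun X => H (X + U)) X := lintegral_mono hpt
    _ = (1 + ENNReal.ofReal η) * (∫⁻ X in cellN N L, kineticDensity Ψ.ψ (X + U)) +
        (1 + ENNReal.ofReal η⁻¹) * ENNReal.ofReal (D ^ 2) * ∫⁻ X in cellN N L, H (X + U) := by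
        rw [lintegral_add_left (hKm.const_mul _), lintegral_const_mul' _ _ (by finiteness),
          lintegral_const_mul' _ _ (by finiteness), lintegral_indicator (measurableSet_cellN N L),
          lintegral_indicator (measurableSet_cellN N L)]
    _ = (1 + ENNReal.ofReal η) * (∫⁻ Y in cellN N L, kineticDensity Ψ.ψ Y) +
        (1 + ENNReal.ofReal η⁻¹) * ENNReal.ofReal (D ^ 2) * ∫⁻ Y in cellN N L, H Y := by
        rw [lintegral_cellN_comp_add hL hKper U, lintegral_cellN_comp_add hL hHper U]
    _ ≤ _ := by
        gcongr
        calc ∫⁻ Y in cellN N L, H Y ≤ ∫⁻ Y in cellN N L, 3 * ((∑ j, rimPot L (Y j)) * G₂ Y) :=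
            setLIntegral_mono' (measurableSet_cellN N L) hHle
          _ = _ := lintegral_const_mul' _ _ (by finiteness)

/-- The interaction is invariant under a common translation of all particles. [folklore] -/
theorem interaction_add_const (v : ℝ → ℝ≥0∞) (X : Config N) (u : Space) :
    interaction v (X + fun _ => u) = interaction v X := by
  unfold interaction
  simp only [Pi.add_apply, dist_add_right]

/-- **Potential energy of the cut-off**: `∫ V |F|² ≤ ∫_{cell} V^per |Ψ|²` for EVERY pair potential
(`|F|² ≤ 1_cell |Ψ(· + U)|²`, `V ≤ V^per`, both `V` and `V^per` are invariant under the common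
translation, and the cell integral of the periodic `V^per|Ψ|²` is translation invariant).
[folklore] -/
theorem lintegral_interaction_cutoff_le (hL : 0 < L) (h8 : 8 * h < L)
    (hq : IsCutoffProfile q (h / 2) (L / 2 + 3 * h) D) (v : ℝ → ℝ≥0∞) (Ψ : PeriodicTrialState N L)
    (u : Space) :
    ∫⁻ X, interaction v X * (‖Ψ.ψ (X + fun _ => u) *
        ((∏ p : Fin N × Fin 3, q (X p.1 p.2) : ℝ) : ℂ)‖₊ : ℝ≥0∞) ^ 2 ≤
      ∫⁻ Y in cellN N L, periodicInteraction v L Y * (‖Ψ.ψ Y‖₊ : ℝ≥0∞) ^ 2 := by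
  set U : Config N := fun _ => u with hU
  have hS : L / 2 + 3 * h + 2 * (h / 2) ≤ L := by linarith
  have hper : ∀ (Y : Config N) (i : Fin N) (k : Fin 3),
      (fun Y => periodicInteraction v L Y * (‖Ψ.ψ Y‖₊ : ℝ≥0∞) ^ 2)
        (Y + Pi.single i (EuclideanSpace.single k L)) =
      (fun Y => periodicInteraction v L Y * (‖Ψ.ψ Y‖₊ : ℝ≥0∞) ^ 2) Y := by
    intro Y i k
    simp only [periodicInteraction_add_single, Ψ.periodic]
  calc _ ≤ ∫⁻ X, (cellN N L).indicator
          (fun X => periodicInteraction v L (X + U) * (‖Ψ.ψ (X + U)‖₊ : ℝ≥0∞) ^ 2) X := by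
        refine lintegral_mono fun X => ?_
        have h1 := ennnorm_cutoff_sq_le_indicator hq.range hq.support hS Ψ.ψ U X
        by_cases hX : X ∈ cellN N L
        · rw [indicator_of_mem hX] at h1 ⊢
          calc _ ≤ interaction v X * (‖Ψ.ψ (X + U)‖₊ : ℝ≥0∞) ^ 2 := by gcongr
            _ ≤ _ := by
                gcongr
                rw [← interaction_add_const v X u]
                exact interaction_le_periodicInteraction v L _
        · rw [indicator_of_notMem hX] at h1 ⊢
          rw [nonpos_iff_eq_zero.1 h1, mul_zero]
    _ = ∫⁻ X in cellN N L, periodicInteraction v L (X + U) * (‖Ψ.ψ (X + U)‖₊ : ℝ≥0∞) ^ 2 :=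
        lintegral_indicator (measurableSet_cellN N L) _
    _ = _ := lintegral_cellN_comp_add hL
        (G := fun Y => periodicInteraction v L Y * (‖Ψ.ψ Y‖₊ : ℝ≥0∞) ^ 2) hper U

/-- **`L²` cost of the cut-off, additive form**: `∫ |F - 1_cell Ψ(·+U)|² + ‖F‖² ≤ 1`
(pointwise `(1 - Q)² + Q² ≤ 1` for `0 ≤ Q ≤ 1`, and `∫_cell |Ψ(·+U)|² = 1`). With
`1 - m ≤ ‖F‖²` this is `∫ |F - 1_cell Ψ(·+U)|² ≤ m`. [folklore] -/
theorem lintegral_cutoff_sub_sq_add_le (hL : 0 < L) (h8 : 8 * h < L)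
    (hq : IsCutoffProfile q (h / 2) (L / 2 + 3 * h) D) (Ψ : PeriodicTrialState N L) (u : Space) :
    (∫⁻ X, (‖Ψ.ψ (X + fun _ => u) * ((∏ p : Fin N × Fin 3, q (X p.1 p.2) : ℝ) : ℂ) -
        (cellN N L).indicator (fun X => Ψ.ψ (X + fun _ => u)) X‖₊ : ℝ≥0∞) ^ 2) +
      ∫⁻ X, (‖Ψ.ψ (X + fun _ => u) * ((∏ p : Fin N × Fin 3, q (X p.1 p.2) : ℝ) : ℂ)‖₊ : ℝ≥0∞) ^ 2
        ≤ 1 := by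
  set U : Config N := fun _ => u with hU
  have hS : L / 2 + 3 * h + 2 * (h / 2) ≤ L := by linarith
  refine (le_lintegral_add _ _).trans ?_
  calc _ ≤ ∫⁻ X, (cellN N L).indicator (fun X => (‖Ψ.ψ (X + U)‖₊ : ℝ≥0∞) ^ 2) X := by
        refine lintegral_mono fun X => ?_
        set Qf : ℝ := ∏ p : Fin N × Fin 3, q (X p.1 p.2) with hQf
        have hQ0 : 0 ≤ Qf := prodCutoff_nonneg hq.range X
        have hQ1 : Qf ≤ 1 := prodCutoff_le_one hq.range X
        by_cases hX : X ∈ cellN N L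
        · rw [indicator_of_mem hX, indicator_of_mem hX]
          have e : Ψ.ψ (X + U) * (Qf : ℂ) - Ψ.ψ (X + U) = ((Qf - 1 : ℝ) : ℂ) * Ψ.ψ (X + U) := by
            push_cast; ring
          rw [e, mul_comm (Ψ.ψ (X + U)) (Qf : ℂ), nnnorm_mul, nnnorm_mul, ENNReal.coe_mul,
            ENNReal.coe_mul, mul_pow, mul_pow, ← add_mul]
          calc _ ≤ 1 * (‖Ψ.ψ (X + U)‖₊ : ℝ≥0∞) ^ 2 := by
                gcongr
                -- `(Qf - 1)² + Qf² ≤ 1`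
                have hr : (Qf - 1) ^ 2 + Qf ^ 2 ≤ 1 := by nlinarith
                have hreal : ∀ r : ℝ, ((‖((r : ℝ) : ℂ)‖₊ : ℝ≥0∞)) ^ 2 = ENNReal.ofReal (r ^ 2) := by
                  intro r
                  rw [Complex.nnnorm_real, ← enorm_eq_nnnorm, Real.enorm_eq_ofReal_abs,
                    ← ENNReal.ofReal_pow (abs_nonneg r), sq_abs]
                have h1 := hreal (Qf - 1)
                have h2 := hreal Qf
                rw [h1, h2, ← ENNReal.ofReal_add (sq_nonneg _) (sq_nonneg _), ← ENNReal.ofReal_one]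
                exact ENNReal.ofReal_le_ofReal hr
            _ = _ := one_mul _
        · have hQ : Qf = 0 := by
            by_contra hne
            exact hX (mem_cellN_of_prodCutoff_ne_zero hq.support hS hne)
          rw [indicator_of_notMem hX, indicator_of_notMem hX, hQ]
          simp
    _ = ∫⁻ X in cellN N L, (‖Ψ.ψ (X + U)‖₊ : ℝ≥0∞) ^ 2 := lintegral_indicator (measurableSet_cellN N L) _
    _ = 1 := by
        rw [lintegral_cellN_comp_add hL (G := fun X => (‖Ψ.ψ X‖₊ : ℝ≥0∞) ^ 2)
          (fun X i k => by rw [Ψ.periodic])]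
        exact Ψ.norm_eq

/-- **Quadratic form of the cut-off**: `∫ |∇F|² + ∫ V|F|² ≤ (1+η) periodicEnergy v Ψ + (1+η⁻¹) D² · 3m`
for every pair potential `v`. [folklore] -/
theorem lintegral_form_cutoff_le (hL : 0 < L) (hh : 0 < h) (h8 : 8 * h < L)
    (hq : IsCutoffProfile q (h / 2) (L / 2 + 3 * h) D) (v : ℝ → ℝ≥0∞) (Ψ : PeriodicTrialState N L)
    {η : ℝ} (hη : 0 < η) :
    (∫⁻ X, kineticDensity (fun X : Config N => Ψ.ψ (X + fun _ =>
        (WithLp.toLp 2 fun _ : Fin 3 => -(2 * h) : Space)) *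
        ((∏ p : Fin N × Fin 3, q (X p.1 p.2) : ℝ) : ℂ)) X) +
      ∫⁻ X, interaction v X * (‖Ψ.ψ (X + fun _ =>
        (WithLp.toLp 2 fun _ : Fin 3 => -(2 * h) : Space)) *
        ((∏ p : Fin N × Fin 3, q (X p.1 p.2) : ℝ) : ℂ)‖₊ : ℝ≥0∞) ^ 2 ≤
      (1 + ENNReal.ofReal η) * periodicEnergy v Ψ +
        (1 + ENNReal.ofReal η⁻¹) * ENNReal.ofReal (D ^ 2) *
          (3 * ∫⁻ Y in cellN N L, (∑ j, rimPot L (Y j)) * (‖Ψ.ψ Y‖₊ : ℝ≥0∞) ^ 2) := by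
  have hsplit : periodicEnergy v Ψ = (∫⁻ Y in cellN N L, kineticDensity Ψ.ψ Y) +
      ∫⁻ Y in cellN N L, periodicInteraction v L Y * (‖Ψ.ψ Y‖₊ : ℝ≥0∞) ^ 2 := by
    unfold periodicEnergy
    rw [lintegral_add_left (measurable_kineticDensity Ψ.contDiff)]
  have hK := lintegral_kineticDensity_cutoff_le hL hh h8 hq Ψ hη
  have hV := lintegral_interaction_cutoff_le hL h8 hq v Ψ
    (WithLp.toLp 2 fun _ : Fin 3 => -(2 * h) : Space)
  have hV' : (∫⁻ X, interaction v X * (‖Ψ.ψ (X + fun _ =>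
        (WithLp.toLp 2 fun _ : Fin 3 => -(2 * h) : Space)) *
        ((∏ p : Fin N × Fin 3, q (X p.1 p.2) : ℝ) : ℂ)‖₊ : ℝ≥0∞) ^ 2) ≤
      (1 + ENNReal.ofReal η) *
        ∫⁻ Y in cellN N L, periodicInteraction v L Y * (‖Ψ.ψ Y‖₊ : ℝ≥0∞) ^ 2 :=
    hV.trans (le_mul_of_one_le_left zero_le le_self_add)
  calc _ ≤ _ := add_le_add hK hV'
    _ = _ := by rw [hsplit]; ring

/-- **Anchor of this block** (quantified form of `lintegral_form_cutoff_le`). [folklore] -/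
theorem stub_hardWallLimit_cutoffEnergy : ∀ {N : ℕ} {L h D : ℝ} {q : ℝ → ℝ}, 0 < L → 0 < h → 8 * h < L → IsCutoffProfile q (h / 2) (L / 2 + 3 * h) D → ∀ (v : ℝ → ℝ≥0∞) (Ψ : PeriodicTrialState N L) (η : ℝ), 0 < η → (∫⁻ X : Config N, kineticDensity (fun X : Config N => Ψ.ψ (X + fun _ => (WithLp.toLp 2 fun _ : Fin 3 => -(2 * h) : Space)) * ((∏ p : Fin N × Fin 3, q (X p.1 p.2) : ℝ) : ℂ)) X) + ∫⁻ X : Config N, interaction v X * (‖Ψ.ψ (X + fun _ => (WithLp.toLp 2 fun _ : Fin 3 => -(2 * h) : Space)) * ((∏ p : Fin N × Fin 3, q (X p.1 p.2) : ℝ) : ℂ)‖₊ : ℝ≥0∞) ^ 2 ≤ (1 + ENNReal.ofReal η) * periodicEnergy v Ψ + (1 + ENNReal.ofReal η⁻¹) * ENNReal.ofReal (D ^ 2) * (3 * ∫⁻ Y in cellN N L, (∑ j, rimPot L (Y j)) * (‖Ψ.ψ Y‖₊ : ℝ≥0∞) ^ 2) :=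
  fun hL hh h8 hq v Ψ _ hη => lintegral_form_cutoff_le hL hh h8 hq v Ψ hη

end Summit.AtomisticToContinuum.BoseEinsteinCondensation.RimSqueeze

end
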